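/-
Copyright: the b2b-balaban cell (near-miss cell 7), T⁴-continuum CRUX team (coordinator ruling e34b3e0c item (2)),
lineage t4-ne7b-formalise-leaf-04 (gen 24). Released under the licence of the surrounding project.
-/
import Mathlib.MeasureTheory.Integral.Prod
import Literature.MathematicalPhysics.QuantumFieldTheory.Balaban1983to89.T4WeightBudget
import HarnessLib

/-!
# The PEIERLS HEALING MAP, kernel half: a healing-closed index family with local quotient bounds delivers
# NE7b's output shape `RelWeightBound` (route R-H of `t4/ROUTES-NE7b.md` v2 — steps H1 (shape), H2, H6-glue)

Cell `pub-balaban`, sub-cell `t4`, spine estimate NE7b (node U5c), candidate route **R-H «Peierls healing map»**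
(rank 1 of `t4/ROUTES-NE7b.md` v2, seat `t4-ne7b-idea-1` gen 2; its §3 asks «owner ∕ leaf-04: H1 = `heal` on
`HIndex` + the ≤ 60-line kernel glue {`sum_le_mul_sum_of_heal`, `term_le_of_quotient`,
`relWeight_le_sum_of_cover`} ⇒ `bad_left` — a theorem ABOUT `RelWeightBound` over existing structures, no new
Support leaf»).  This module is that kernel half, placed under `Spine/NE7b/` as crux-route work (like
`…NE7b.LocalPlaquetteExpMoments` for route R-T1); it types NO new `T4Continuum/Support` leaf and asserts nothing.

THE ROUTE IN ONE SENTENCE (the idea seat's, quoted for context).  For each OLD PENDING large-field component `C`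
(pinned: birth scale, anchor, full sub-history) the map `H ↦ H ∖ C` («heal `C`»: replace its large-field
expression by the corresponding small-field expression — the numerator∕denominator of the renormalisation
quotient (0.3) p. 176 of [Balaban1989LargeFieldI], used as a COMPARISON MAP at the final level, not as an
operation) sends the terms containing `C` injectively to terms, and `A(H) ≤ q_K(C)·A(H ∖ C)` with `q_K(C)` the sup
over the exterior field of the local quotient; hence `Σ_{H ∋ C} A ≤ q_K(C)·Σ_{T K} A` with NO global denominator, and
the union bound over pinned `C` gives the relative weight `W K := Σ_C q_K(C)` of the bad class — in EACH run.

WHAT IS PROVED HERE (kernel; [folklore] finite sums + Bochner∕Fubini bookkeeping; zero `sorry`, no hypothesis of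
Bałaban's minted, no `[cite:]`-asserted fact; every analytic input of R-H stays a DISPLAYED hypothesis):
* §1 `sum_le_mul_sum_of_heal` — heal injective on the bad sub-class, lands in `T`, `a b ≤ q·a(heal b)`, `a ≥ 0` ⟹
  `Σ_{Bad_C} a ≤ q·Σ_T a` (= the `hx` of the tree's `T4WeightBudget.relWeight_le_sum_of_cover`);
  `sum_le_sum_mul_sum_of_heals` — the cover over pinned components, BY NAME through `relWeight_le_sum_of_cover`.
* §2 `HealingLaws l₀ T A Bad X Badx heal q` — THE HYPOTHESIS SHAPE a healing witness for ONE run must inhabit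
  (H1: `bad_subset`, `cover`, `heal_mem`, `heal_injOn`; H2∕H3-output: `le_heal` with SOURCE-UNIFORM quotients
  `q K x ≥ 0`); `HealingLaws.bad_le` (⟹ `Σ_{Bad K t} A ≤ (Σ_{x ∈ X K} q K x)·Σ_{T K} A`);
  **`relWeightBound_of_healing`** — two runs' healing laws over the SAME term sets and bad classes + a common
  summable majorant `W K ≥ Σ_x q K x`, `W K < 1` from `K₀` on ⟹ `T4WeightBudget.RelWeightBound` (early steps
  emptied, via the tree's `relWeightBound_of_eventually`): `bad_left` AND `bad_right`;
  **`exists_relWeightBound_of_healing_majorant`** — H6-glue: if `Σ_x q K x ≤ V·r^{K − j⋆(K)}` with `0 < r < 1`,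
  `0 ≤ V`, `c·K ≤ K − j⋆(K)` (the tree's two-rate majorant shape, `summable_weightMajorant` ∕
  `eventually_weightMajorant_lt`), then SOME `K₀` gives the `RelWeightBound`.
* §3 H2, analytic forms: `le_mul_of_ratio_le` (a ratio bound with `{den = 0} ⊆ {num = 0}` IS a product bound —
  prediction PH-c's role), `integral_le_mul_integral_of_le` (pointwise ⟹ integrated), and the FUBINI form
  **`integral_prod_le_mul_of_fibre_le`**: on a product `E × F` (exterior × the `C`-fibre), a quotient bound
  FIBREWISE in the exterior variable, `∫_F num(e,·) ≤ q·∫_F den(e,·)`, gives `∫ num ≤ q·∫ den` — the shape of (0.3)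
  («∫dV⌈_{Z′}» inside, exterior frozen); `integral_le_mul_integral_of_fibre_le_split` — the same on ONE configuration
  space split `Ω ≃ᵐ E × F` compatibly with its measure (links outside ∕ inside the healed component).
* §4 = the sibling module `…NE7b.HealingMapCarrier` (imports this file + the lineage's carrier M1∕M2-A
  `B16HistoryIndexedRepr`∕`…Family`): the level-preserving lift of a healing map to `HIndex.Idx`, the propagation of
  a local bound through a positive operation, weight-level H2 (pointwise and FIBRE form) and the END over
  `T := HIndex.termSet I`, `A K t := weight μ RA t`.  THIS file imports only `T4WeightBudget` + Mathlib.

NOT HERE (honest).  H1 as a READING (which indices are «old pending components», that healing preserves the other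
components' admissibility — [R], M2-B∕M4 name the components); H3 (the local quotient bound `q_K(C) ≤ e^{−κ−…}`,
[NEW-local] + [P-type]); H4∕H5 (banked slack, age ⇒ events); the count bounding `Σ_C q_K(C)` by the two-rate
majorant.  All enter as the displayed fields of `HealingLaws` ∕ the hypothesis `hmaj`.  BY-NAME EFFECT ON THE WALL
(`WALL-NE7b-P1.md` §2): NONE.  NE7b (`T4WeightBudget.RelWeightBound`) is the cell's OWN estimate — NOT PRINTED in
[Bałaban 1983–89], NOT PROVED; spine PROVED 0∕9; rung (B)+1 on a FINITE torus T⁴ — NOT infinite volume, NOT the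
mass gap, NOT Clay.
HONEST DEPENDENCY: continuum YM on T⁴ ⇐ BetaPertH ∧ nine spine estimates (0/9 proved); BetaPertH ⇐ (D1) ∧ (D4) ∧
CAP+tail; G-an2-4 gates asym, D1 and NE2/3/4.  This file changes none of it.
-/

set_option autoImplicit false

open Finset MeasureTheory
open Literature.MathematicalPhysics.QuantumFieldTheory.Balaban1983to89
open Literature.MathematicalPhysics.QuantumFieldTheory.Balaban1983to89.T4WeightBudget

namespace Summit.QuantumFields.BalabanUV.T4Continuum.NE7b.HealingMap

/-! ## §1 The healing inequality (H1 + H2 ⟹ the `hx` of `relWeight_le_sum_of_cover`) -/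

section Heal

variable {α β : Type*} [DecidableEq β]

/-- **THE HEALING INEQUALITY** (route R-H, steps H1 + H2 combined; the idea seat's `HealSketch.sum_le_mul_sum_of_heal`).
If the healing map sends every bad term to a term (`hmem`), is injective on the bad sub-class (`hinj` — trivial once
the healed component is pinned with its full sub-history: `H = (H ∖ C) ⊔ C`), every bad weight is at most `q` times
its healed weight (`hle`, the sup-quotient), `q ≥ 0`, and all weights on `T` are non-negative, then the bad sub-class
has relative weight at most `q` — with NO global denominator. [folklore] -/
theorem sum_le_mul_sum_of_heal (Bad T : Finset β) {a : β → ℝ} (heal : β → β) {q : ℝ}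
    (ha : ∀ b ∈ T, 0 ≤ a b) (hq : 0 ≤ q) (hmem : ∀ b ∈ Bad, heal b ∈ T)
    (hinj : Set.InjOn heal ↑Bad) (hle : ∀ b ∈ Bad, a b ≤ q * a (heal b)) :
    ∑ b ∈ Bad, a b ≤ q * ∑ b ∈ T, a b :=
  calc ∑ b ∈ Bad, a b ≤ ∑ b ∈ Bad, q * a (heal b) := Finset.sum_le_sum hle
    _ = q * ∑ b ∈ Bad.image heal, a b := by rw [Finset.mul_sum, Finset.sum_image hinj]
    _ ≤ q * ∑ b ∈ T, a b :=
        mul_le_mul_of_nonneg_left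
          (Finset.sum_le_sum_of_subset_of_nonneg (Finset.image_subset_iff.mpr hmem)
            fun b hb _ => ha b hb) hq

/-- **THE HEALING INEQUALITY SUMMED OVER PINNED COMPONENTS** (H1 + H2 + the union bound, BY NAME through the tree's
`T4WeightBudget.relWeight_le_sum_of_cover`): if the bad class is covered by the sub-classes `Badx x` («terms
containing the pinned old component `x`»), `x ∈ X`, each healed by its own injective map `heal x` into `T` with
quotient `q x ≥ 0`, then `Σ_{Bad} a ≤ (Σ_{x ∈ X} q x)·Σ_T a`. [folklore] -/
theorem sum_le_sum_mul_sum_of_heals (X : Finset α) (Badx : α → Finset β) (heal : α → β → β) (q : α → ℝ)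
    {Bad T : Finset β} {a : β → ℝ} (ha : ∀ b, 0 ≤ a b) (hcov : Bad ⊆ X.biUnion Badx)
    (hq : ∀ x ∈ X, 0 ≤ q x) (hmem : ∀ x ∈ X, ∀ b ∈ Badx x, heal x b ∈ T)
    (hinj : ∀ x ∈ X, Set.InjOn (heal x) ↑(Badx x))
    (hle : ∀ x ∈ X, ∀ b ∈ Badx x, a b ≤ q x * a (heal x b)) :
    ∑ b ∈ Bad, a b ≤ (∑ x ∈ X, q x) * ∑ b ∈ T, a b :=
  relWeight_le_sum_of_cover X Badx ha hcov fun x hx =>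
    sum_le_mul_sum_of_heal (Badx x) T (heal x) (fun b _ => ha b) (hq x hx) (hmem x hx) (hinj x hx) (hle x hx)

end Heal

/-! ## §2 The hypothesis shape of a healing witness, and the END `RelWeightBound` -/

section Laws

variable {ι α α' : Type*}

/-- **HEALING LAWS for ONE run** (the hypothesis SHAPE route R-H must inhabit; displayed, never asserted).  Data:
per cutoff `K`, a finite set `X K` of PINNED OLD COMPONENTS (source-free), for each `x` the sub-class `Badx K x` of
terms containing it, the healing map `heal K x` on term indices and a SOURCE-UNIFORM quotient `q K x` (the sup over
the exterior field AND over `|t| ≤ l₀` of the local quotient — the observable tilt costs a `t`-uniform factor per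
component, route text H2).  Laws: (H1) the bad class consists of terms, is covered by the `Badx`, healing lands in
`T K` and is injective on each `Badx K x`; (H2 + H3's output) `A K t τ ≤ q K x · A K t (heal K x τ)` for every bad
term, `|t| ≤ l₀`, with `q K x ≥ 0`. [folklore] -/
structure HealingLaws (l₀ : ℝ) (T : ℕ → Finset ι) (A : ℕ → ℝ → ι → ℝ) (Bad : ℕ → ℝ → Finset ι)
    (X : ℕ → Finset α) (Badx : ℕ → α → Finset ι) (heal : ℕ → α → ι → ι) (q : ℕ → α → ℝ) : Prop where
  /-- the bad class consists of terms -/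
  bad_subset : ∀ K t, |t| ≤ l₀ → Bad K t ⊆ T K
  /-- every bad term contains some pinned old component -/
  cover : ∀ K t, |t| ≤ l₀ → ∀ τ ∈ Bad K t, ∃ x ∈ X K, τ ∈ Badx K x
  /-- healing a pinned component yields a term (healing-closedness of the index family) -/
  heal_mem : ∀ K, ∀ x ∈ X K, ∀ τ ∈ Badx K x, heal K x τ ∈ T K
  /-- healing a PINNED component is injective -/
  heal_injOn : ∀ K, ∀ x ∈ X K, Set.InjOn (heal K x) ↑(Badx K x)
  /-- the quotients are non-negative -/
  q_nonneg : ∀ K, ∀ x ∈ X K, 0 ≤ q K x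
  /-- the sup-quotient bound: a bad term weighs at most `q` times its healed term, uniformly in the source -/
  le_heal : ∀ K t, |t| ≤ l₀ → ∀ x ∈ X K, ∀ τ ∈ Badx K x, A K t τ ≤ q K x * A K t (heal K x τ)

variable {l₀ : ℝ} {T : ℕ → Finset ι} {A B : ℕ → ℝ → ι → ℝ} {Bad : ℕ → ℝ → Finset ι}
  {X : ℕ → Finset α} {Badx : ℕ → α → Finset ι} {heal : ℕ → α → ι → ι} {q : ℕ → α → ℝ}
  {X' : ℕ → Finset α'} {Badx' : ℕ → α' → Finset ι} {heal' : ℕ → α' → ι → ι} {q' : ℕ → α' → ℝ}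

/-- **ONE RUN**: healing laws + non-negative weights ⟹ the bad class has relative weight `≤ Σ_{x ∈ X K} q K x` at
every cutoff and every `|t| ≤ l₀`. [folklore] -/
theorem HealingLaws.bad_le (h : HealingLaws l₀ T A Bad X Badx heal q)
    (hA : ∀ K t, |t| ≤ l₀ → ∀ τ, 0 ≤ A K t τ) (K : ℕ) (t : ℝ) (ht : |t| ≤ l₀) :
    ∑ τ ∈ Bad K t, A K t τ ≤ (∑ x ∈ X K, q K x) * ∑ τ ∈ T K, A K t τ := by
  classical
  have hcov : Bad K t ⊆ (X K).biUnion (Badx K) := fun τ hτ => Finset.mem_biUnion.mpr (h.cover K t ht τ hτ)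
  exact sum_le_sum_mul_sum_of_heals (X K) (Badx K) (heal K) (q K) (hA K t ht) hcov (h.q_nonneg K)
    (h.heal_mem K) (h.heal_injOn K) (h.le_heal K t ht)

/-- The total of the quotients is non-negative. [folklore] -/
theorem HealingLaws.sum_q_nonneg (h : HealingLaws l₀ T A Bad X Badx heal q) (K : ℕ) :
    0 ≤ ∑ x ∈ X K, q K x :=
  Finset.sum_nonneg (h.q_nonneg K)

/-- **THE END OF ROUTE R-H, KERNEL HALF: two runs' healing laws ⟹ NE7b's output shape `RelWeightBound`.**  Healing
laws for run A (pinned components `X`, quotients `q`) and for run B (`X'`, `q'`) over the SAME source-free term sets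
`T K` and bad classes `Bad K t`, non-negative weights, and a common majorant `W` with `Σ_x q K x ≤ W K`,
`Σ_x q' K x ≤ W K`, `W K < 1` for `K ≥ K₀` and `Σ_K W K < ∞` give `T4WeightBudget.RelWeightBound` with the bad
classes EMPTIED and the weights ZEROED below `K₀` (the tree's `relWeightBound_of_eventually`).  Every analytic input
of the route (H1 reading, H3 quotient bound, the count behind `W`) is a hypothesis here. [folklore] -/
theorem relWeightBound_of_healing {K₀ : ℕ} {W : ℕ → ℝ}
    (hA : HealingLaws l₀ T A Bad X Badx heal q) (hB : HealingLaws l₀ T B Bad X' Badx' heal' q')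
    (hA0 : ∀ K t, |t| ≤ l₀ → ∀ τ, 0 ≤ A K t τ) (hB0 : ∀ K t, |t| ≤ l₀ → ∀ τ, 0 ≤ B K t τ)
    (hWA : ∀ K, K₀ ≤ K → ∑ x ∈ X K, q K x ≤ W K) (hWB : ∀ K, K₀ ≤ K → ∑ x ∈ X' K, q' K x ≤ W K)
    (h1 : ∀ K, K₀ ≤ K → W K < 1) (hs : Summable W) :
    RelWeightBound l₀ T A B (fun K t => if K₀ ≤ K then Bad K t else ∅) (Set.indicator {K | K₀ ≤ K} W) :=
  relWeightBound_of_eventually (fun K t ht _ => hA.bad_subset K t ht)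
    (fun K hK => (hA.sum_q_nonneg K).trans (hWA K hK)) h1 hs
    (fun K t ht hK => (hA.bad_le hA0 K t ht).trans
      (mul_le_mul_of_nonneg_right (hWA K hK) (Finset.sum_nonneg fun τ _ => hA0 K t ht τ)))
    (fun K t ht hK => (hB.bad_le hB0 K t ht).trans
      (mul_le_mul_of_nonneg_right (hWB K hK) (Finset.sum_nonneg fun τ _ => hB0 K t ht τ)))

/-- **H6-GLUE: healing laws + the two-rate majorant ⟹ `RelWeightBound` from SOME `K₀` on.**  If both runs' quotient
totals are bounded by the tree's weight majorant `V·r^{K − j⋆(K)}` (`0 < r < 1`, `0 ≤ V`, and the matching scale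
leaves a positive fraction of old steps, `c·K ≤ K − j⋆(K)`; this is where the COUNT of pinned genealogies with a
per-event decay enters — a hypothesis here), then the majorant is summable and eventually `< 1`
(`T4WeightBudget.summable_weightMajorant` ∕ `eventually_weightMajorant_lt`), so some `K₀` yields the
`RelWeightBound`. [folklore] -/
theorem exists_relWeightBound_of_healing_majorant {r V c : ℝ} {jstar : ℕ → ℕ}
    (hA : HealingLaws l₀ T A Bad X Badx heal q) (hB : HealingLaws l₀ T B Bad X' Badx' heal' q')
    (hA0 : ∀ K t, |t| ≤ l₀ → ∀ τ, 0 ≤ A K t τ) (hB0 : ∀ K t, |t| ≤ l₀ → ∀ τ, 0 ≤ B K t τ)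
    (h0 : 0 < r) (hr1 : r < 1) (hV : 0 ≤ V) (hc : 0 < c)
    (hfrac : ∀ K : ℕ, c * K ≤ ((K - jstar K : ℕ) : ℝ))
    (hmajA : ∀ K, ∑ x ∈ X K, q K x ≤ V * r ^ (K - jstar K))
    (hmajB : ∀ K, ∑ x ∈ X' K, q' K x ≤ V * r ^ (K - jstar K)) :
    ∃ K₀ : ℕ, RelWeightBound l₀ T A B (fun K t => if K₀ ≤ K then Bad K t else ∅)
      (Set.indicator {K | K₀ ≤ K} fun K => V * r ^ (K - jstar K)) := by
  obtain ⟨K₀, hK₀⟩ := Filter.eventually_atTop.mp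
    (eventually_weightMajorant_lt h0 hr1 hV hc one_pos hfrac)
  exact ⟨K₀, relWeightBound_of_healing hA hB hA0 hB0 (fun K _ => hmajA K) (fun K _ => hmajB K) hK₀
    (summable_weightMajorant h0 hr1 hV hc hfrac)⟩

end Laws

/-! ## §3 H2 — the quotient step, analytic forms (pointwise, integrated, Fubini) -/

section Quotient

/-- A RATIO bound is a PRODUCT bound once `{den = 0} ⊆ {num = 0}` (the route's remark under H2: both carry the same
small-field characteristic functions on the collar of the healed component; prediction PH-c tests exactly this).
[folklore] -/
theorem le_mul_of_ratio_le {num den q : ℝ} (hden : 0 ≤ den) (hzero : den = 0 → num = 0)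
    (hratio : den ≠ 0 → num / den ≤ q) : num ≤ q * den := by
  by_cases hd : den = 0
  · rw [hzero hd, hd, mul_zero]
  · exact (div_le_iff₀ (lt_of_le_of_ne hden (Ne.symm hd))).mp (hratio hd)

variable {Ω : Type*} [MeasurableSpace Ω] {μ : Measure Ω}

/-- **H2, integrated form** (the idea seat's `HealSketch.term_le_of_quotient`): a pointwise (a.e.) bound
`num ≤ q·den` between a non-negative function and an integrable one integrates to `∫ num ≤ q·∫ den`. [folklore] -/
theorem integral_le_mul_integral_of_le {num den : Ω → ℝ} {q : ℝ} (hnum : 0 ≤ᵐ[μ] num)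
    (hden : Integrable den μ) (hle : num ≤ᵐ[μ] fun ω => q * den ω) :
    ∫ ω, num ω ∂μ ≤ q * ∫ ω, den ω ∂μ := by
  rw [← integral_const_mul]
  exact integral_mono_of_nonneg hnum (hden.const_mul q) hle

variable {E F : Type*} [MeasurableSpace E] [MeasurableSpace F] {μE : Measure E} {μF : Measure F}
  [SFinite μE] [SFinite μF]

/-- **H2, FUBINI FORM — the shape of the quotient (0.3)**: on the product of the EXTERIOR configuration space `E` and
the `C`-FIBRE `F`, if the fibre integrals satisfy `∫_F num(e,·) ≤ q·∫_F den(e,·)` for a.e. frozen exterior `e` (the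
sup-quotient bound, pointwise in the exterior field; nothing outside the fibre is opened), then
`∫ num ≤ q·∫ den` over the product measure. [folklore] -/
theorem integral_prod_le_mul_of_fibre_le {num den : E × F → ℝ} {q : ℝ} (hnum0 : ∀ z, 0 ≤ num z)
    (hnum : Integrable num (μE.prod μF)) (hden : Integrable den (μE.prod μF))
    (hfib : ∀ᵐ e ∂μE, ∫ f, num (e, f) ∂μF ≤ q * ∫ f, den (e, f) ∂μF) :
    ∫ z, num z ∂(μE.prod μF) ≤ q * ∫ z, den z ∂(μE.prod μF) := by
  rw [integral_prod num hnum, integral_prod den hden]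
  exact integral_le_mul_integral_of_le
    (Filter.Eventually.of_forall fun e => integral_nonneg fun f => hnum0 (e, f))
    hden.integral_prod_left hfib

/-- **H2, FUBINI FORM ON A SPLIT CONFIGURATION SPACE**: the same, for a configuration space `Ω` (one cutoff's field
space with its reference measure `μ`) SPLIT by a measurable equivalence `e : Ω ≃ᵐ E × F` into exterior × `C`-fibre
with `μ ↦ μE ⊗ μF` (for a product Haar measure over links: the links outside ∕ inside the healed component).  A
quotient bound between the fibre integrals at a.e. frozen exterior gives `∫ num dμ ≤ q·∫ den dμ`. [folklore] -/
theorem integral_le_mul_integral_of_fibre_le_split (e : Ω ≃ᵐ E × F) (hμ : μ.map e = μE.prod μF)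
    {num den : Ω → ℝ} {q : ℝ} (hnum0 : ∀ ω, 0 ≤ num ω) (hnum : Integrable num μ) (hden : Integrable den μ)
    (hfib : ∀ᵐ x ∂μE, ∫ f, num (e.symm (x, f)) ∂μF ≤ q * ∫ f, den (e.symm (x, f)) ∂μF) :
    ∫ ω, num ω ∂μ ≤ q * ∫ ω, den ω ∂μ := by
  have key : ∀ g : Ω → ℝ, ∫ ω, g ω ∂μ = ∫ z, g (e.symm z) ∂(μE.prod μF) := fun g => by
    rw [← hμ, integral_map_equiv]
    simp only [MeasurableEquiv.symm_apply_apply]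
  have hint : ∀ g : Ω → ℝ, Integrable g μ → Integrable (fun z => g (e.symm z)) (μE.prod μF) := fun g hg => by
    rw [← hμ]
    refine (integrable_map_equiv e _).mpr ?_
    have : (fun z => g (e.symm z)) ∘ e = g := funext fun ω => by simp
    rw [this]
    exact hg
  rw [key num, key den]
  exact integral_prod_le_mul_of_fibre_le (fun z => hnum0 (e.symm z)) (hint num hnum) (hint den hden) hfib

end Quotient

end Summit.QuantumFields.BalabanUV.T4Continuum.NE7b.HealingMap
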